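import Summits.Parity.GeneralizedHardyLittlewood.Theses.GapLimitPointSplit

/-!
# Route `GapLimitPointSplit` — the `[assembly]` item (stmt-Parity-31668)

decomp-parity node «GapLimitPointSplit» (lens-2 g7; critic CLEARED HOME/STATUS.md l.345, CRITIC-LEDGER row 67;
route born rev 0, commit b758201dd918; ROUTE-AS-BORN CLEARED l.364): the assembly
`BoundedSiegelZeroQuality → FixedUpper → FixedLower → ThreePoint → GapLift → GeneralizedHardyLittlewood` is literally
the route's gate-written deciding theorem `closes` (D-0027 §2.1), curried.  Hand by the cell's prover-class seat; no
mathematics beyond the route file.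
-/

namespace Summit.Parity.GeneralizedHardyLittlewood.Theses.GapLimitPointSplit

/-- **The `[assembly]` item holds** (stmt-Parity-31668): the five route items imply
`GeneralizedHardyLittlewood`, by the route's deciding theorem `closes`. -/
theorem assembly_proof : Assembly :=
  fun hQ hFU hFL hN hR => closes hQ hFU hFL hN hR

end Summit.Parity.GeneralizedHardyLittlewood.Theses.GapLimitPointSplit
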